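import Summits.ABC.StewartYu.PadicG3TwoMain
import Summits.ABC.StewartYu.PadicG3TwoThirdClass
import Summits.ABC.StewartYu.DirectionalRecombination
import HarnessLib

/-!
# Cell abc-stewartyu, Gen-3 frame at `p = 2` (crux `Y07Two`, stmt-ABC-19659), layer F5d: the RE-INDEXING after
# the Kummer `3`-descent — class `v`, sub-family `u = 3u′ + v`, `Y₀`-basis `R′ = R ∘ (Y₀/3)`, and the vanishing
# of the re-indexed family's values at the integers COPRIME TO `3` from the vanishing of the class sums

`Summits/ABC/StewartYu/PadicG3TwoThirdReindex.lean` — cell `abc-stewartyu` (HOME `run/shared/lean/pub/abc-stewartyu/`),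
route `PadicPrimesKummerThird`, seat p5 (g3) (split of F5 with the F-two lead p3-g5, STATUS 01:3xZ: p3 = values /
class sums / Liouville, p5 = re-indexing + the `ThirdStepTwo` assembly).  One definition (`G3Fam.reindex3`) and
theorems on `TwoSetup`, on top of p3-g5's `PadicG3TwoThirdClass` (`res3`, `qPart3`, `thirdVec`) and p5's
`PadicG3TwoMain` (`G3Fam`, `vanish`); no named fact.

THE STEP (Yu 2013 Lemma 5.4, (5.50)–(5.57); Nesterenko 2003 §4.3 (4.50)–(4.51) at `q = 3`).  After the third
point `s/3` (`3 ∤ s`) has produced the vanishing of every triadic class sum `thirdVec B p τ s r`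
(`PadicG3TwoThirdClass` + the multicubic Liouville step), fix a class `v ∈ {0,1,2}^{d+1}` of EXPONENT VECTORS
`κᵢ = (uᵢ, u_θᵢ) (mod 3)` (`= res3 κᵢ 1`).  On the sub-family `B_v` write `κᵢ = 3κᵢ′ + v`; then
`qPart3 κᵢ s = zmon(κᵢ′, s) · ∏ₖ allₖ^{⌊vₖ s/3⌋}` (`qPart3_eq_of_cls`), `res3 κᵢ s = res3 v s`, and for `3 ∤ s` the
unknowns of `B` with `res3 κᵢ s = res3 v s` are EXACTLY `B_v` (`filter_res3_eq_of_not_dvd`).  With the rescaled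
basis `Rᵢ′ = Rᵢ ∘ (Y₀/3)` one has `(Hasse_{t₀} Rᵢ)(s/3) = 3^{t₀}·(Hasse_{t₀} Rᵢ′)(s)` (`eval_hasseDeriv_comp_third`),
and the directional coefficients are affine, `zγⱼ(κᵢ) = 3·zγⱼ(κᵢ′) + zγⱼ(v)`; since the class-sum identities hold
for ALL multi-indices `t` below a bound (a downward-closed range), binomial recombination
(`DirectionalRecombination.sum_mul_prod_affine_pow_eq_zero`) converts them into the NATIVE identities
`g3φ R′ u′ u_θ′ B_v p τ s = 0` of the re-indexed family at every `3 ∤ s` in range — `vanish_cop_reindex3`, the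
input `Λ′.vanish nodesCop (N0 (I+1)) (T0 (I+1))` of `PadicG3TwoMain.ThirdStepTwo`.

WHAT THIS IS NOT: no Liouville (p3-g5), no admissibility transport / numerics (sequel `PadicG3TwoThirdStep`);
no crux moves.

References: K. Yu, Acta Math. 211 (2013), Lemma 5.4 (5.44)–(5.57); Yu. V. Nesterenko, LNM 1819 (2003), §4.3
(4.50)–(4.51); K. Yu, Compositio Math. 74 (1990), §3.
-/

noncomputable section

open Finset Polynomial
open Literature.NumberTheory.Transcendental
open Literature.NumberTheory.Transcendental.CW77.Setup (Tau tauNorm)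

namespace Summit.ABC.StewartYu

namespace TwoSetup

variable (S : TwoSetup) {ι : Type*}

/-! ### Classes of exponent vectors modulo `3` -/

/-- The integer representative `v̂ ∈ {0,1,2}^{d+1} ⊂ ℤ^{d+1}` of a residue vector. [folklore] -/
abbrev repr3 (v : Fin (S.d + 1) → Fin 3) : Fin (S.d + 1) → ℤ := fun k => ((v k : ℕ) : ℤ)

/-- `res3 κ 1` is the residue class of `κ` itself: `((res3 κ 1) k : ℤ) = κ k % 3`. [folklore] -/
theorem res3_one_coe (κ : Fin (S.d + 1) → ℤ) (k : Fin (S.d + 1)) :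
    (((S.res3 κ 1 k : Fin 3) : ℕ) : ℤ) = κ k % 3 := by
  rw [S.res3_coe, mul_one]

/-- On the class `res3 κ 1 = v`: `κₖ = 3·((κₖ − v̂ₖ)/3) + v̂ₖ`. [folklore] -/
theorem eq_three_mul_add_of_cls {κ : Fin (S.d + 1) → ℤ} {v : Fin (S.d + 1) → Fin 3} (h : S.res3 κ 1 = v)
    (k : Fin (S.d + 1)) : κ k = 3 * ((κ k - S.repr3 v k) / 3) + S.repr3 v k := by
  have hk : κ k % 3 = S.repr3 v k := by
    rw [← S.res3_one_coe κ k, h]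
  unfold repr3 at hk ⊢
  omega

/-- The residues of a representative: `v̂ₖ % 3 = v̂ₖ`. [folklore] -/
theorem repr3_emod (v : Fin (S.d + 1) → Fin 3) (k : Fin (S.d + 1)) : S.repr3 v k % 3 = S.repr3 v k := by
  unfold repr3
  have := (v k).isLt
  omega

/-- On the class `v`, `res3 κ s = res3 v̂ s` for every `s`. [folklore] -/
theorem res3_eq_of_cls {κ : Fin (S.d + 1) → ℤ} {v : Fin (S.d + 1) → Fin 3} (h : S.res3 κ 1 = v) (s : ℤ) :
    S.res3 κ s = S.res3 (S.repr3 v) s := by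
  funext k
  apply Fin.ext
  have e1 := S.res3_coe κ s k
  have e2 := S.res3_coe (S.repr3 v) s k
  have hκ := S.eq_three_mul_add_of_cls h k
  have : (κ k * s) % 3 = (S.repr3 v k * s) % 3 := by
    rw [hκ, add_mul, mul_assoc, add_comm, Int.add_mul_emod_self_left]
  exact_mod_cast (e1.trans (this.trans e2.symm))

/-- **For `3 ∤ s` the class at `s` determines the class**: `res3 κ s = res3 v̂ s → res3 κ 1 = v`.
[cite: Yu2013, (5.44)–(5.45); shape only] -/
theorem cls_eq_of_res3_eq {κ : Fin (S.d + 1) → ℤ} {v : Fin (S.d + 1) → Fin 3} {s : ℤ} (hs : ¬ (3 : ℤ) ∣ s)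
    (h : S.res3 κ s = S.res3 (S.repr3 v) s) : S.res3 κ 1 = v := by
  funext k
  apply Fin.ext
  have hk : S.res3 κ s k = S.res3 (S.repr3 v) s k := congrFun h k
  have e : (κ k * s) % 3 = (S.repr3 v k * s) % 3 := by
    rw [← S.res3_coe, ← S.res3_coe, hk]
  have hdvd : (3 : ℤ) ∣ (κ k - S.repr3 v k) * s := by
    rw [sub_mul]
    exact Int.ModEq.dvd e.symm
  rcases (Int.prime_three.dvd_or_dvd hdvd) with h3 | h3
  · have hmod : κ k % 3 = S.repr3 v k % 3 :=
      Int.emod_eq_emod_iff_emod_sub_eq_zero.mpr (Int.emod_eq_zero_of_dvd h3)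
    have := S.res3_one_coe κ k
    rw [hmod, S.repr3_emod] at this
    unfold repr3 at this
    exact_mod_cast this
  · exact absurd h3 hs

/-- **The unknowns whose exponent class at `s` is that of `v` are exactly the class-`v` sub-family** (`3 ∤ s`).
[cite: Yu2013, (5.50); shape only] -/
theorem filter_res3_eq_of_not_dvd (u : ι → Fin S.d → ℤ) (uθ : ι → ℤ) (B : Finset ι)
    (v : Fin (S.d + 1) → Fin 3) {s : ℤ} (hs : ¬ (3 : ℤ) ∣ s) :
    (B.filter fun i => S.res3 (Fin.snoc (u i) (uθ i)) s = S.res3 (S.repr3 v) s) =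
      B.filter fun i => S.res3 (Fin.snoc (u i) (uθ i)) 1 = v := by
  ext i
  simp only [Finset.mem_filter, and_congr_right_iff]
  intro _
  exact ⟨fun h => S.cls_eq_of_res3_eq hs h, fun h => S.res3_eq_of_cls h s⟩

/-! ### The re-indexed family -/

namespace G3Fam

variable {S}

/-- **The RE-INDEXED FAMILY of the class `v`** after a Kummer `3`-descent: unknowns `B_v = {i ∈ B : κᵢ ≡ v (3)}`,
exponents `κᵢ′ = (κᵢ − v̂)/3`, `Y₀`-basis `Rᵢ′ = Rᵢ ∘ (Y₀/3)`, the same coefficients, base point `i₀′`.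
[cite: Yu2013, Lemma 5.4 (5.57) and (5.1)(i); shape only] -/
def reindex3 (Λ : S.G3Fam ι) (v : Fin (S.d + 1) → Fin 3) (i₀' : ι) : S.G3Fam ι where
  B := Λ.B.filter fun i => S.res3 (Fin.snoc (Λ.u i) (Λ.uθ i)) 1 = v
  R := fun i => (Λ.R i).comp (C (3⁻¹ : ℚ) * X)
  u := fun i j => (Λ.u i j - S.repr3 v (Fin.castSucc j)) / 3
  uθ := fun i => (Λ.uθ i - S.repr3 v (Fin.last S.d)) / 3
  p := Λ.p
  i₀ := i₀'

variable (Λ : S.G3Fam ι) (v : Fin (S.d + 1) → Fin 3) (i₀' : ι)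

/-- Members of the re-indexed family. [folklore] -/
theorem mem_reindex3_B {i : ι} :
    i ∈ (Λ.reindex3 v i₀').B ↔ i ∈ Λ.B ∧ S.res3 (Fin.snoc (Λ.u i) (Λ.uθ i)) 1 = v := by
  unfold reindex3; exact Finset.mem_filter

/-- The re-indexed family is a sub-family. [folklore] -/
theorem reindex3_B_subset : (Λ.reindex3 v i₀').B ⊆ Λ.B := by
  unfold reindex3; exact Finset.filter_subset _ _

/-- **`κᵢ = 3κᵢ′ + v̂` on the class** (free generators). [folklore] -/
theorem u_eq_of_mem {i : ι} (hi : i ∈ (Λ.reindex3 v i₀').B) (j : Fin S.d) :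
    Λ.u i j = 3 * (Λ.reindex3 v i₀').u i j + S.repr3 v (Fin.castSucc j) := by
  have h := ((Λ.mem_reindex3_B v i₀').mp hi).2
  have := S.eq_three_mul_add_of_cls h (Fin.castSucc j)
  simp only [Fin.snoc_castSucc] at this
  exact this

/-- **`κᵢ = 3κᵢ′ + v̂` on the class** (the generator `θ`). [folklore] -/
theorem uθ_eq_of_mem {i : ι} (hi : i ∈ (Λ.reindex3 v i₀').B) :
    Λ.uθ i = 3 * (Λ.reindex3 v i₀').uθ i + S.repr3 v (Fin.last S.d) := by
  have h := ((Λ.mem_reindex3_B v i₀').mp hi).2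
  have := S.eq_three_mul_add_of_cls h (Fin.last S.d)
  simp only [Fin.snoc_last] at this
  exact this

/-- The exponent vector over all generators, re-indexed: `snoc κ = 3·snoc κ′ + v̂` on the class. [folklore] -/
theorem snoc_eq_of_mem {i : ι} (hi : i ∈ (Λ.reindex3 v i₀').B) (k : Fin (S.d + 1)) :
    (Fin.snoc (Λ.u i) (Λ.uθ i) : Fin (S.d + 1) → ℤ) k =
      3 * (Fin.snoc ((Λ.reindex3 v i₀').u i) ((Λ.reindex3 v i₀').uθ i) : Fin (S.d + 1) → ℤ) k + S.repr3 v k := by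
  refine Fin.lastCases ?_ (fun j => ?_) k
  · simp only [Fin.snoc_last]; exact Λ.uθ_eq_of_mem v i₀' hi
  · simp only [Fin.snoc_castSucc]; exact Λ.u_eq_of_mem v i₀' hi j

/-- **The directional coefficients are affine under re-indexing**: `zγⱼ(κᵢ) = 3·zγⱼ(κᵢ′) + zγⱼ(v̂)` on the
class. [cite: Nesterenko2003, §4.3 (4.50)] -/
theorem zγ_eq_of_mem {i : ι} (hi : i ∈ (Λ.reindex3 v i₀').B) (j : Fin S.d) :
    S.zγ (Λ.u i) (Λ.uθ i) j =
      3 * S.zγ ((Λ.reindex3 v i₀').u i) ((Λ.reindex3 v i₀').uθ i) j +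
        S.zγ (fun j => S.repr3 v (Fin.castSucc j)) (S.repr3 v (Fin.last S.d)) j := by
  unfold zγ
  rw [Λ.u_eq_of_mem v i₀' hi j, Λ.uθ_eq_of_mem v i₀' hi]
  push_cast
  ring

end G3Fam

/-! ### The rational part on the class and the rescaled `Y₀`-basis -/

/-- **`qPart3 κ s = zmon(κ′, s) · ∏ₖ allₖ^{⌊v̂ₖ s/3⌋}` on the class** (`κ = 3κ′ + v̂`).
[cite: Yu2013, (5.51)–(5.52); shape only] -/
theorem qPart3_eq_of_cls (u' : Fin S.d → ℤ) (uθ' : ℤ) (v : Fin (S.d + 1) → Fin 3)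
    (κ : Fin (S.d + 1) → ℤ)
    (hκ : ∀ k, κ k = 3 * (Fin.snoc u' uθ' : Fin (S.d + 1) → ℤ) k + S.repr3 v k) (s : ℤ) :
    S.qPart3 κ s = S.zmon u' uθ' s * ∏ k : Fin (S.d + 1), S.toQ.all k ^ (S.repr3 v k * s / 3) := by
  rw [S.zmon_eq_prod_all u' uθ' s]
  unfold qPart3
  rw [← Finset.prod_mul_distrib]
  refine Finset.prod_congr rfl fun k _ => ?_
  rw [← zpow_add₀ (S.toQ.all_ne k)]
  congr 1
  rw [hκ k]
  have e : (3 * (Fin.snoc u' uθ' : Fin (S.d + 1) → ℤ) k + S.repr3 v k) * s =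
      S.repr3 v k * s + 3 * ((Fin.snoc u' uθ' : Fin (S.d + 1) → ℤ) k * s) := by ring
  rw [e, Int.add_mul_ediv_left _ _ (by norm_num : (3 : ℤ) ≠ 0)]
  unfold allExp
  refine Fin.lastCases ?_ (fun j => ?_) k
  · simp only [Fin.snoc_last]; ring
  · simp only [Fin.snoc_castSucc]; ring

/-- **Hasse derivatives of a linearly rescaled polynomial**:
`Hasse_t (f ∘ (c·Y)) = c^t · (Hasse_t f) ∘ (c·Y)`. [folklore] -/
theorem hasseDeriv_comp_C_mul_X {K : Type*} [Field K] (f : K[X]) (c : K) (t : ℕ) :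
    hasseDeriv t (f.comp (C c * X)) = C (c ^ t) * (hasseDeriv t f).comp (C c * X) := by
  induction f using Polynomial.induction_on' with
  | add p q hp hq =>
    rw [Polynomial.add_comp, map_add, hp, hq, map_add, Polynomial.add_comp, mul_add]
  | monomial n r =>
    -- `(monomial n r) ∘ (cX) = monomial n (r c^n)`
    have hcomp : ∀ (m : ℕ) (a : K), (monomial m a).comp (C c * X) = monomial m (a * c ^ m) := by
      intro m a
      rw [Polynomial.monomial_comp, mul_pow, ← C_pow, ← mul_assoc, ← map_mul,
        Polynomial.C_mul_X_pow_eq_monomial]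
    rw [hcomp, hasseDeriv_monomial, hasseDeriv_monomial, hcomp, Polynomial.C_mul_monomial]
    by_cases htn : t ≤ n
    · congr 1
      obtain ⟨m, rfl⟩ := Nat.exists_eq_add_of_le htn
      rw [Nat.add_sub_cancel_left, pow_add]
      ring
    · rw [not_le] at htn
      rw [Nat.choose_eq_zero_of_lt htn]
      simp

/-- **The original weight at the third point vs the rescaled weight at the integer**:
`(Hasse_{t₀} R)(s/3) = 3^{t₀}·(Hasse_{t₀} (R ∘ (Y₀/3)))(s)`. [cite: Yu2013, (5.5)–(5.6); shape only] -/
theorem eval_hasseDeriv_comp_third (f : ℚ[X]) (t : ℕ) (s : ℤ) :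
    (hasseDeriv t f).eval ((s : ℚ) / 3) =
      (3 : ℚ) ^ t * (hasseDeriv t (f.comp (C (3⁻¹ : ℚ) * X))).eval (s : ℚ) := by
  rw [hasseDeriv_comp_C_mul_X, Polynomial.eval_mul, Polynomial.eval_C, Polynomial.eval_comp,
    Polynomial.eval_mul, Polynomial.eval_C, Polynomial.eval_X, ← mul_assoc, ← mul_pow,
    mul_inv_cancel₀ (by norm_num : (3 : ℚ) ≠ 0), one_pow, one_mul, div_eq_inv_mul]

/-! ### From vanishing class sums to the re-indexed family's native identities -/

/-- The class sum of `v` at a point `s` with `3 ∤ s`, rewritten on the re-indexed family: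
`thirdVec B p τ s (res3 v̂ s) = 3^{t₀}·(∏ₖ allₖ^{⌊v̂ₖ s/3⌋})·∑_{i ∈ B_v} pᵢ·(Hasse_{t₀}Rᵢ′)(s)·∏ⱼ zγⱼ(κᵢ)^{tⱼ}·zmon(κᵢ′,s)`.
[cite: Yu2013, (5.50)–(5.53); shape only] -/
theorem thirdVec_cls_eq (Λ : S.G3Fam ι) (v : Fin (S.d + 1) → Fin 3) (i₀' : ι) (τ : Tau S.d) {s : ℤ}
    (hs : ¬ (3 : ℤ) ∣ s) :
    S.thirdVec Λ.R Λ.u Λ.uθ Λ.B Λ.p τ s (S.res3 (S.repr3 v) s) =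
      (3 : ℚ) ^ τ.1 * (∏ k : Fin (S.d + 1), S.toQ.all k ^ (S.repr3 v k * s / 3)) *
        ∑ i ∈ (Λ.reindex3 v i₀').B, (Λ.p i : ℚ) *
          (hasseDeriv τ.1 ((Λ.reindex3 v i₀').R i)).eval (s : ℚ) * S.zγpow Λ.u Λ.uθ i τ.2 *
            S.zmon ((Λ.reindex3 v i₀').u i) ((Λ.reindex3 v i₀').uθ i) s := by
  unfold thirdVec
  rw [S.filter_res3_eq_of_not_dvd Λ.u Λ.uθ Λ.B v hs]
  change ∑ i ∈ (Λ.reindex3 v i₀').B, _ = _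
  rw [Finset.mul_sum]
  refine Finset.sum_congr rfl fun i hi => ?_
  rw [S.qPart3_eq_of_cls ((Λ.reindex3 v i₀').u i) ((Λ.reindex3 v i₀').uθ i) v _
      (Λ.snoc_eq_of_mem v i₀' hi) s, eval_hasseDeriv_comp_third]
  unfold G3Fam.reindex3
  simp only
  ring

/-- **RE-INDEXING: the native identities of the class-`v` family at the integers coprime to `3`.**  If every
triadic class sum vanishes at all `|s| ≤ N` with `3 ∤ s` and all `|τ| < T`, then for every class `v` (and any
base point) the re-indexed family's rational values `g3φ R′ κ′ B_v p τ s` vanish at the same points — the input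
`Λ′.vanish nodesCop N T` of `PadicG3TwoMain.ThirdStepTwo`. [cite: Yu2013, Lemma 5.4 (5.50)–(5.57)]
[cite: Nesterenko2003, §4.3 (4.50)–(4.51)] -/
theorem vanish_cop_reindex3 (Λ : S.G3Fam ι) {N T : ℕ}
    (h : ∀ s : ℤ, |s| ≤ (N : ℤ) → ¬ (3 : ℤ) ∣ s → ∀ τ : Tau S.d, tauNorm τ < T →
      S.thirdVec Λ.R Λ.u Λ.uθ Λ.B Λ.p τ s = 0)
    (v : Fin (S.d + 1) → Fin 3) (i₀' : ι) :
    (Λ.reindex3 v i₀').vanish nodesCop N T := by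
  classical
  intro x hx h3 τ hτ
  set Λ' := Λ.reindex3 v i₀' with hΛ'
  -- the common nonzero factor
  have hc : (3 : ℚ) ^ τ.1 * (∏ k : Fin (S.d + 1), S.toQ.all k ^ (S.repr3 v k * x / 3)) ≠ 0 :=
    mul_ne_zero (pow_ne_zero _ (by norm_num))
      (Finset.prod_ne_zero_iff.mpr fun k _ => zpow_ne_zero _ (S.toQ.all_ne k))
  -- the identities with the OLD directional coefficients, for every `t ≤ τ.2`
  have hold : ∀ ν : Fin S.d → ℕ, (∀ j, ν j ≤ τ.2 j) →
      ∑ i ∈ Λ'.B, ((Λ.p i : ℚ) * (hasseDeriv τ.1 (Λ'.R i)).eval (x : ℚ) * S.zmon (Λ'.u i) (Λ'.uθ i) x : ℂ) *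
        ∏ j, ((S.zγ (Λ.u i) (Λ.uθ i) j : ℚ) : ℂ) ^ ν j = 0 := by
    intro ν hν
    have hτ' : tauNorm ((τ.1, ν) : Tau S.d) < T := by
      have : ∑ j, ν j ≤ ∑ j, τ.2 j := Finset.sum_le_sum fun j _ => hν j
      unfold tauNorm at hτ ⊢
      simp only at hτ ⊢
      omega
    have hvan := h x hx h3 (τ.1, ν) hτ' 
    have hcls := congrFun hvan (S.res3 (S.repr3 v) x)
    rw [Pi.zero_apply, S.thirdVec_cls_eq Λ v i₀' (τ.1, ν) h3] at hcls
    have hsum := (mul_eq_zero.mp hcls).resolve_left hc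
    -- cast to `ℂ`
    have hcast := congrArg (fun q : ℚ => (q : ℂ)) hsum
    simp only [Rat.cast_zero, Rat.cast_sum] at hcast
    rw [← hcast]
    refine Finset.sum_congr rfl fun i _ => ?_
    unfold zγpow
    push_cast
    ring
  -- binomial recombination: new coefficients `zγ′ = 3⁻¹·zγ − 3⁻¹·zγ(v̂)`
  have hnew := GenThreeVanishing.sum_mul_prod_affine_pow_eq_zero Λ'.B
    (fun i => ((Λ.p i : ℚ) * (hasseDeriv τ.1 (Λ'.R i)).eval (x : ℚ) * S.zmon (Λ'.u i) (Λ'.uθ i) x : ℂ))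
    (fun i j => ((S.zγ (Λ.u i) (Λ.uθ i) j : ℚ) : ℂ))
    (fun _ => ((3⁻¹ : ℚ) : ℂ))
    (fun j => ((-(3⁻¹ : ℚ) * S.zγ (fun j => S.repr3 v (Fin.castSucc j)) (S.repr3 v (Fin.last S.d)) j : ℚ) : ℂ))
    τ.2 hold
  -- the recombined scalars are the NEW directional coefficients
  have hγ : ∀ i ∈ Λ'.B, ∀ j : Fin S.d,
      ((3⁻¹ : ℚ) : ℂ) * ((S.zγ (Λ.u i) (Λ.uθ i) j : ℚ) : ℂ) +
        ((-(3⁻¹ : ℚ) * S.zγ (fun j => S.repr3 v (Fin.castSucc j)) (S.repr3 v (Fin.last S.d)) j : ℚ) : ℂ) =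
      ((S.zγ (Λ'.u i) (Λ'.uθ i) j : ℚ) : ℂ) := by
    intro i hi j
    rw [Λ.zγ_eq_of_mem v i₀' hi j]
    push_cast
    ring
  have hnew' : ∑ i ∈ Λ'.B,
      ((Λ.p i : ℚ) * (hasseDeriv τ.1 (Λ'.R i)).eval (x : ℚ) * S.zmon (Λ'.u i) (Λ'.uθ i) x : ℂ) *
        ∏ j, ((S.zγ (Λ'.u i) (Λ'.uθ i) j : ℚ) : ℂ) ^ τ.2 j = 0 := by
    rw [← hnew]
    refine Finset.sum_congr rfl fun i hi => ?_
    congr 1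
    exact Finset.prod_congr rfl fun j _ => by rw [hγ i hi j]
  have hfin : ((S.g3φ Λ'.R Λ'.u Λ'.uθ Λ'.B Λ'.p τ x : ℚ) : ℂ) = 0 := by
    rw [← hnew']
    unfold g3φ zγpow
    push_cast
    refine Finset.sum_congr rfl fun i _ => ?_
    have : Λ'.p = Λ.p := rfl
    rw [this]
    ring
  exact_mod_cast hfin

end TwoSetup

end Summit.ABC.StewartYu

end
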